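import Summits.AnomalousDissipation.AnomalousDissipation.Theorems.ImpulseGridMeanMomentumBalance
import Literature.Analysis.FluidPDE.LerayHopfSpectralMeasurability

/-!
# Assembly of route ImpulseGrid (item stmt-AnomalousDissipation-1776 `Assembly`)

`GridInjectionIdentity → GridThesis → AnomalousDissipation`.

From the thesis `X` take the design `(Φ, Ψ, G, c, η, Λ)` and the family `(ν, u₀, u)` with its
per-`j` sup-in-time energy bounds, the uniform mean-energy bound `E`, no leakage and the two grid
sign conditions. For each `j` the first conjunct of the grid injection identity, with
`∫ΦΨ|G|² = 0`, (a) and (b), gives `c·Λ⟨(f,u_j)⟩ ≥ η − ν_j·Λ⟨(u_j, Δ(Ψ•G))⟩`. The viscous pairing is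
bounded uniformly in `j`: the Cesàro means satisfy
`T⁻¹∫₀ᵀ⟨u_j,ΔΦ₀⟩ ≤ ‖ΔΦ₀‖_∞ · ½(1 + T⁻¹∫₀ᵀ‖u_j‖₂²)` (`‖u‖ ≤ ½(1+‖u‖²)` on the probability space
`T³`; integrability in time of both slice functionals along a Leray–Hopf solution), the energy
means are eventually below `E + 1` (`limsup = meanEnergy ≤ E`), and `Λ ≤ limsup` on eventually
bounded functions. Choosing `J` with `ν_j` small for `j ≥ J` (`ν → 0`) gives
`Λ⟨(f,u_j)⟩ ≥ η/(2c)`, then `Λ ≤ limsup = longTimeAvgSup ≤ meanDissipation` by the no-leakage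
clause, and the zeroth law follows along the reindexed tail `j ↦ j + J`
(Doering–Foias 2002, §2; Foias–Manley–Rosa–Temam 2001, Ch. IV §1 for the generalized limits).

No new definitions.
-/

noncomputable section

open MeasureTheory Set Filter Topology
open scoped InnerProductSpace RealInnerProductSpace

-- `Summit.<Summit>.<Problem>` is the tree's mandated summit-side namespace (CONVENTIONS §2); for this
-- single-conjunct summit the two coincide, so the duplicate is deliberate.
set_option linter.dupNamespace false

namespace Summit.AnomalousDissipation.AnomalousDissipation.Theorems

open Literature.Analysis.FunctionSpaces Literature.Analysis.FunctionSpaces.Torus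
open Literature.Analysis.FluidPDE Literature.Analysis.FluidPDE.Torus

variable {ν : ℝ} {f a u₀ : UnitAddTorus (Fin 3) → EuclideanSpace ℝ (Fin 3)}
  {u : ℝ → UnitAddTorus (Fin 3) → EuclideanSpace ℝ (Fin 3)}

/-- Cesàro means of a function bounded by `M` in absolute value on `t > 0` are bounded by `M` in
absolute value for every `T > 0` (no integrability needed:
`intervalIntegral.norm_integral_le_of_norm_le_const`). [folklore] -/
theorem impulseGrid_abs_timeMean_le {g : ℝ → ℝ} {M : ℝ} (hg : ∀ t, 0 < t → |g t| ≤ M) {T : ℝ}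
    (hT : 0 < T) : |timeMean g T| ≤ M := by
  have h1 : ‖∫ t in (0 : ℝ)..T, g t‖ ≤ M * |T - 0| := by
    refine intervalIntegral.norm_integral_le_of_norm_le_const fun t ht => ?_
    rw [uIoc_of_le hT.le] at ht
    rw [Real.norm_eq_abs]
    exact hg t ht.1
  rw [sub_zero, abs_of_pos hT, Real.norm_eq_abs] at h1
  unfold timeMean
  rw [abs_mul, abs_inv, abs_of_pos hT]
  calc T⁻¹ * |∫ t in (0 : ℝ)..T, g t| ≤ T⁻¹ * (M * T) :=
      mul_le_mul_of_nonneg_left h1 (inv_nonneg.2 hT.le)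
    _ = M := by rw [mul_comm M T, ← mul_assoc, inv_mul_cancel₀ hT.ne', one_mul]

/-- A generalized limit of a function eventually trapped in `[b, a]` is at most `a`
(`Λ ≤ limsup ≤ a`; Doering–Foias 2002, §2). [folklore] -/
theorem impulseGrid_generalizedLimit_le (Λ : GeneralizedLimit) {g : ℝ → ℝ} {a b : ℝ}
    (hb : ∀ᶠ t in atTop, b ≤ g t) (ha : ∀ᶠ t in atTop, g t ≤ a) : Λ g ≤ a := by
  have h₁ : IsBoundedUnder (· ≤ ·) atTop g := ⟨a, ha⟩
  have h₂ : IsBoundedUnder (· ≥ ·) atTop g := ⟨b, hb⟩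
  exact (Λ.le_limsup h₁ h₂).trans (limsup_le_of_le h₂.isCoboundedUnder_le ha)

/-- Cesàro means of the energy `‖u(t)‖₂²` are bounded by `2C` when `½‖u(t)‖₂² ≤ C` for all
`t ≥ 0`. [folklore] -/
theorem impulseGrid_timeMean_energy_le {C : ℝ} (hC : ∀ t : ℝ, 0 ≤ t → kineticEnergy (u t) ≤ C)
    {T : ℝ} (hT : 0 < T) : timeMean (fun t => ∫ x, ‖u t x‖ ^ 2) T ≤ 2 * C := by
  have hg : ∀ t : ℝ, 0 < t → |∫ x, ‖u t x‖ ^ 2| ≤ 2 * C := by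
    intro t ht
    rw [abs_of_nonneg (integral_nonneg fun x => sq_nonneg _)]
    have h := hC t ht.le
    simp only [kineticEnergy] at h
    linarith
  exact (le_abs_self _).trans (impulseGrid_abs_timeMean_le hg hT)

/-- **Cesàro mean of a pairing against the Cesàro mean of the energy.** Along a global
Leray–Hopf solution, for a continuous field `a` with `‖a‖ ≤ K` and every `T > 0`,
`T⁻¹∫₀ᵀ ⟨u(t), a⟩ dt ≤ K · ½ (1 + T⁻¹∫₀ᵀ ‖u(t)‖₂² dt)`: pointwise `|⟨u(t),a⟩| ≤ K∫‖u(t)‖ ≤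
K·½(1 + ‖u(t)‖₂²)`, and both slice functionals are integrable in time on `(0, T]`
(`IsLerayHopfOn.integrableOn_integral_inner`, `IsGlobalLerayHopf.integrableOn_integral_norm_sq`),
so the pointwise bound integrates. [folklore] -/
theorem impulseGrid_timeMean_inner_le (hu : Torus.IsGlobalLerayHopf ν (fun _ => f) u₀ u)
    (ha : Continuous a) {K : ℝ} (hK0 : 0 ≤ K) (hK : ∀ x, ‖a x‖ ≤ K) {T : ℝ} (hT : 0 < T) :
    timeMean (fun t => ∫ x, ⟪u t x, a x⟫) T ≤
      K * (2⁻¹ * (1 + timeMean (fun t => ∫ x, ‖u t x‖ ^ 2) T)) := by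
  have hBint : IntegrableOn (fun t => ∫ x, ⟪u t x, a x⟫) (Ioc 0 T) :=
    (integrableOn_Ioc_iff_integrableOn_Ioo).2 ((hu T hT).integrableOn_integral_inner ha)
  have heint : IntegrableOn (fun t => ∫ x, ‖u t x‖ ^ 2) (Ioc 0 T) :=
    hu.integrableOn_integral_norm_sq hT
  have hconst : IntegrableOn (fun _ : ℝ => (1 : ℝ)) (Ioc 0 T) :=
    integrableOn_const (hs := measure_Ioc_lt_top.ne)
  have hrhs : IntegrableOn (fun t => K * (2⁻¹ * (1 + ∫ x, ‖u t x‖ ^ 2))) (Ioc 0 T) :=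
    ((hconst.add heint).const_mul 2⁻¹).const_mul K
  -- pointwise bound on the slices `t ∈ (0, T]`
  have hpt : ∀ t ∈ Ioc (0 : ℝ) T, ∫ x, ⟪u t x, a x⟫ ≤ K * (2⁻¹ * (1 + ∫ x, ‖u t x‖ ^ 2)) := by
    intro t ht
    have hmem : MemLp (u t) 2 volume := hu.memLp_two ht.1.le
    have h1 := abs_integral_inner_le_of_norm_le (hmem.integrable one_le_two) hK
    have h2 := integral_norm_le_of_memLp_two hmem
    exact (le_abs_self _).trans (h1.trans (mul_le_mul_of_nonneg_left h2 hK0))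
  have hmono : ∫ t in Ioc 0 T, ∫ x, ⟪u t x, a x⟫ ≤
      ∫ t in Ioc 0 T, K * (2⁻¹ * (1 + ∫ x, ‖u t x‖ ^ 2)) :=
    setIntegral_mono_on hBint hrhs measurableSet_Ioc hpt
  have hev : ∫ t in Ioc 0 T, K * (2⁻¹ * (1 + ∫ x, ‖u t x‖ ^ 2)) =
      K * (2⁻¹ * (T + ∫ t in Ioc 0 T, ∫ x, ‖u t x‖ ^ 2)) := by
    rw [integral_const_mul, integral_const_mul, integral_add hconst heint, setIntegral_const,
      Real.volume_real_Ioc_of_le hT.le, sub_zero, smul_eq_mul, mul_one]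
  have hT0 : T ≠ 0 := hT.ne'
  simp only [timeMean, intervalIntegral.integral_of_le hT.le]
  calc T⁻¹ * ∫ t in Ioc 0 T, ∫ x, ⟪u t x, a x⟫
        ≤ T⁻¹ * (K * (2⁻¹ * (T + ∫ t in Ioc 0 T, ∫ x, ‖u t x‖ ^ 2))) :=
      mul_le_mul_of_nonneg_left (hmono.trans_eq hev) (inv_nonneg.2 hT.le)
    _ = K * (2⁻¹ * (T⁻¹ * T + T⁻¹ * ∫ t in Ioc 0 T, ∫ x, ‖u t x‖ ^ 2)) := by ring
    _ = K * (2⁻¹ * (1 + T⁻¹ * ∫ t in Ioc 0 T, ∫ x, ‖u t x‖ ^ 2)) := by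
      rw [inv_mul_cancel₀ hT0]

/-- **Uniform bound on the generalized mean of a pairing.** Along a global Leray–Hopf solution
with `sup_{t ≥ 0} ½‖u(t)‖₂² ≤ C` and mean energy `⟨‖u‖₂²⟩ ≤ E`, for a continuous field `a` with
`‖a‖ ≤ K` and any generalized limit `Λ`: `Λ⟨(u, a)⟩ ≤ K · ½ (1 + (E + 1))` — a bound that does
NOT depend on `C`. The Cesàro means of the pairing are eventually below that constant
(`impulseGrid_timeMean_inner_le` and `limsup` of the energy means `= meanEnergy ≤ E < E + 1`),
bounded below by the sup-energy bound, and `Λ ≤ limsup` on eventually bounded functions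
(Doering–Foias 2002, §2). [folklore] -/
theorem impulseGrid_longTimeAvg_inner_le (Λ : GeneralizedLimit)
    (hu : Torus.IsGlobalLerayHopf ν (fun _ => f) u₀ u) (ha : Continuous a) {K : ℝ} (hK0 : 0 ≤ K)
    (hK : ∀ x, ‖a x‖ ≤ K) {C : ℝ} (hC : ∀ t : ℝ, 0 ≤ t → kineticEnergy (u t) ≤ C) {E : ℝ}
    (hE : meanEnergy u ≤ E) :
    Λ.longTimeAvg (fun t => ∫ x, ⟪u t x, a x⟫) ≤ K * (2⁻¹ * (1 + (E + 1))) := by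
  -- the Cesàro means of the energy are eventually below `E + 1`
  have he_bdd : IsBoundedUnder (· ≤ ·) atTop (timeMean fun t => ∫ x, ‖u t x‖ ^ 2) := by
    have h : ∀ᶠ T in atTop, timeMean (fun t => ∫ x, ‖u t x‖ ^ 2) T ≤ 2 * C := by
      filter_upwards [eventually_gt_atTop (0 : ℝ)] with T hT
      exact impulseGrid_timeMean_energy_le hC hT
    exact ⟨2 * C, h⟩
  have hlimsup : limsup (timeMean fun t => ∫ x, ‖u t x‖ ^ 2) atTop ≤ E := by
    rw [meanEnergy_eq_longTimeAvgSup] at hE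
    exact hE
  have he_ev : ∀ᶠ T in atTop, timeMean (fun t => ∫ x, ‖u t x‖ ^ 2) T < E + 1 :=
    eventually_lt_of_limsup_lt (hlimsup.trans_lt (lt_add_one E)) he_bdd
  -- hence the Cesàro means of the pairing are eventually below the claimed bound
  have hB_up : ∀ᶠ T in atTop,
      timeMean (fun t => ∫ x, ⟪u t x, a x⟫) T ≤ K * (2⁻¹ * (1 + (E + 1))) := by
    filter_upwards [he_ev, eventually_gt_atTop (0 : ℝ)] with T hTe hT
    have hTe' : timeMean (fun t => ∫ x, ‖u t x‖ ^ 2) T ≤ E + 1 := hTe.le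
    refine (impulseGrid_timeMean_inner_le hu ha hK0 hK hT).trans ?_
    gcongr
  -- and bounded below (per-solution bound from the sup-energy hypothesis)
  have hB_lo : ∀ᶠ T in atTop,
      -(K * (2⁻¹ * (1 + 2 * C))) ≤ timeMean (fun t => ∫ x, ⟪u t x, a x⟫) T := by
    filter_upwards [eventually_gt_atTop (0 : ℝ)] with T hT
    have hg : ∀ t : ℝ, 0 < t → |∫ x, ⟪u t x, a x⟫| ≤ K * (2⁻¹ * (1 + 2 * C)) := fun t ht =>
      impulseGrid_abs_integral_inner_le hu hK0 hK hC ht.le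
    exact (abs_le.1 (impulseGrid_abs_timeMean_le hg hT)).1
  exact impulseGrid_generalizedLimit_le Λ hB_lo hB_up

/-- **Assembly of route ImpulseGrid** (closes item stmt-AnomalousDissipation-1776):
`GridInjectionIdentity → GridThesis → AnomalousDissipation`. For each `j` the injection identity
with `∫ΦΨ|G|² = 0`, no reversal (a) and early relaxation (b) gives
`c·Λ⟨(f,u_j)⟩ ≥ η − ν_j Λ⟨(u_j,Δ(Ψ•G))⟩ ≥ η − ν_j·K'` with `K'` uniform in `j`
(`impulseGrid_longTimeAvg_inner_le`); for `j ≥ J` (`ν_j → 0`) this is `≥ η/2`, so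
`η/(2c) ≤ Λ⟨(f,u_j)⟩ ≤ limsup = longTimeAvgSup ≤ meanDissipation` (no leakage), and the zeroth law
holds along the tail `j ↦ j + J` with `ε = η/(2c)` (Doering–Foias 2002, §2). [folklore] -/
theorem impulseGridAssembly_proof :
    Summit.AnomalousDissipation.AnomalousDissipation.Theses.ImpulseGrid.Assembly := by
  unfold Summit.AnomalousDissipation.AnomalousDissipation.Theses.ImpulseGrid.Assembly
  intro hI hX
  obtain ⟨Φ, Ψ, G, c, η, Λ, hΦ, hΨ, hG, hΨinv, hGinv, hG0, hGdiv, hdΨ, hΦΨG, hfs, hfdiv, hfmean,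
    hc, hη, ν, u₀, u, hν, hν0, hLH, hsup, -, ⟨E, hE⟩, hnoleak, ha, hb⟩ := hX
  -- a uniform bound for the viscous pairing `Λ⟨(u_j, Δ(Ψ•G))⟩`
  have hΦ₀ : IsSmooth (fun y => Ψ y • G y) := hΨ.smul' hG
  obtain ⟨K, hK0, hK⟩ :=
    exists_nonneg_forall_norm_le_of_continuous hΦ₀.laplacian.continuous
  obtain ⟨KB, hKBpos, hBle⟩ : ∃ KB : ℝ, 0 < KB ∧ ∀ j, Λ.longTimeAvg (fun t => ∫ x,
      ⟪u j t x, laplacian (fun y => Ψ y • G y) x⟫) ≤ KB := by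
    refine ⟨max (K * (2⁻¹ * (1 + (E + 1)))) 1, lt_of_lt_of_le one_pos (le_max_right _ _),
      fun j => ?_⟩
    obtain ⟨C, hC⟩ := hsup j
    exact (impulseGrid_longTimeAvg_inner_le Λ (hLH j) hΦ₀.laplacian.continuous hK0 hK hC
      (hE j)).trans (le_max_left _ _)
  -- choose the tail: `ν_j · KB ≤ η/2` for `j ≥ J`
  obtain ⟨J, hJ⟩ : ∃ J : ℕ, ∀ j ≥ J, ν j < η / (2 * KB) :=
    eventually_atTop.1 (hν0.eventually (gt_mem_nhds (by positivity)))
  -- the dissipation floor along the tail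
  have hfloor : ∀ j, J ≤ j → η / (2 * c) ≤ meanDissipation (ν j) (u j) := by
    intro j hj
    obtain ⟨C, hC⟩ := hsup j
    have hid := (hI Λ (ν j) c Φ Ψ G (u₀ j) (u j) (hν j) hΦ hΨ hG hΨinv hGinv hG0 hGdiv hdΨ
      (hLH j) ⟨C, hC⟩).1
    rw [hΦΨG, sub_zero] at hid
    have h1 : ν j * Λ.longTimeAvg (fun t => ∫ x,
        ⟪u j t x, laplacian (fun y => Ψ y • G y) x⟫) ≤ ν j * KB :=
      mul_le_mul_of_nonneg_left (hBle j) (hν j).le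
    have h2 : ν j * KB ≤ η / 2 := by
      have h := hJ j hj
      rw [lt_div_iff₀ (by positivity)] at h
      linarith
    have h3 : 0 ≤ c * Λ.longTimeAvg (fun t => ∫ x, ⟪G x, u j t x⟫) := mul_nonneg hc.le (ha j)
    have h4 := hb j
    -- so `c · Λ⟨(f, u_j)⟩ ≥ η / 2`
    have h5 : η / 2 ≤ c * Λ.longTimeAvg (fun t => ∫ x, ⟪Φ x • G x, u j t x⟫) := by
      rw [hid]
      linarith
    have h6 : η / (2 * c) ≤ Λ.longTimeAvg (fun t => ∫ x, ⟪Φ x • G x, u j t x⟫) := by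
      rw [div_le_iff₀ (by positivity)]
      linarith
    -- `Λ ≤ limsup` on the bounded Cesàro means of the injection, then no leakage
    refine h6.trans (le_trans ?_ (hnoleak j))
    obtain ⟨Kf, hKf0, hKf⟩ := exists_nonneg_forall_norm_le_of_continuous hfs.continuous
    have hg : ∀ t : ℝ, 0 < t → |∫ x, ⟪Φ x • G x, u j t x⟫| ≤ Kf * (2⁻¹ * (1 + 2 * C)) := by
      intro t ht
      have h := impulseGrid_abs_integral_inner_le (Φ₀ := fun x => Φ x • G x) (hLH j) hKf0 hKf
        hC ht.le
      simpa only [real_inner_comm] using h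
    have hup : ∀ᶠ T in atTop, timeMean (fun t => ∫ x, ⟪Φ x • G x, u j t x⟫) T ≤
        Kf * (2⁻¹ * (1 + 2 * C)) := by
      filter_upwards [eventually_gt_atTop (0 : ℝ)] with T hT
      exact (abs_le.1 (impulseGrid_abs_timeMean_le hg hT)).2
    have hlo : ∀ᶠ T in atTop, -(Kf * (2⁻¹ * (1 + 2 * C))) ≤
        timeMean (fun t => ∫ x, ⟪Φ x • G x, u j t x⟫) T := by
      filter_upwards [eventually_gt_atTop (0 : ℝ)] with T hT
      exact (abs_le.1 (impulseGrid_abs_timeMean_le hg hT)).1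
    exact Λ.le_limsup ⟨_, hup⟩ ⟨_, hlo⟩
  -- the zeroth law along the reindexed tail `j ↦ j + J`
  show Literature.Turb.ZerothLaw
  exact ⟨fun x => Φ x • G x, hfs, hfdiv, hfmean, fun j => ν (j + J), fun j => u₀ (j + J),
    fun j => u (j + J), fun j => hν _, hν0.comp (tendsto_add_atTop_nat J), fun j => hLH _,
    ⟨E, fun j => hE _⟩, η / (2 * c), by positivity, fun j => hfloor (j + J) (Nat.le_add_left J j)⟩

end Summit.AnomalousDissipation.AnomalousDissipation.Theorems

end
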